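import Literature.Barriers.AtomisticToContinuum.HardDiskGibbsMeasurability
import Mathlib.Data.Fintype.CardEmbedding
import HarnessLib

/-!
# The Ruelle estimate for the hard-disc specification: the finite-volume computation behind
# Richthammer 2007, Lemma 3 (property of the Ruelle bound, `ξ = 1`)

Companion of `HardDiskTranslationInvarianceSteps.lean`, towards the discharge of the named fact
`Literature.Barriers.AtomisticToContinuum.HardDisk.Richthammer2007_lemma3`
[Richthammer2007, §3.3 Lemma 3 (3.4), §3.4 Lemma 4 (a), proof §4.2]. The printed proof of
Lemma 3 evaluates, for `f ≥ 0` supported in `Λ^m` and a boundary condition `X̄`, the Poisson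
expectation of `∑≠_{x₁,…,x_m ∈ X_Λ} f(x₁,…,x_m) e^{-H_Λ(X)} z^{#X_Λ}` by the (multivariate Mecke)
identity `∫ ν_Λ(dX|X̄) ∑≠_{x_i ∈ X_Λ} f(x) g(X) = ∫_{Λ^m} dx f(x) ∫ ν_Λ(dX'|X̄) g({x₁,…,x_m} ∪ X')`
and then bounds the correlation function by the Ruelle bound, which for a purely repulsive
interaction is `ξ = 1` because "all energy terms are nonnegative" (Lemma 4 (a)). For the
hard-disc weights `weight z Λ Y` of `HardDiskTranslationInvariance.lean`
(`∑_k (z^k/k!) ∫_{Λ^k} 1_A 1[hard core] dx`, the un-normalised `γ_Λ(·|Y)`), this file proves the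
resulting inequality in closed form, with the hard core made explicit (all in the plane
`ℝ² = EuclideanSpace ℝ (Fin 2)`):

* `tsum_injective_indicator_le_sum_embedding` — inside the configuration
  `superpose Λ x Y = ({x₁,…,x_k} ∩ Λ) ∪ (Y ∩ Λᶜ)`, the sum of `1_{Λ^m} f` over injective
  `m`-tuples of points is at most `∑_{σ : Fin m ↪ Fin k} f(x ∘ σ)` (the tuples in `Λ` are drawn
  from the thrown points);
* `hardCoreIn_superpose_of_range_subset` — `e^{-H} ≤ 1`, `e^{-W} ≤ 1` for the hard core:
  removing thrown points preserves the hard-core constraint;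
* `lintegral_comp_embedding_mul_indicator_le` — splitting `Λ^k = Λ^m × Λ^{k-m}` along `σ`
  (`Fin m ⊕ Fin (k - m) ≃ range σ ⊕ (range σ)ᶜ ≃ Fin k`, `measurePreserving_piCongrLeft`,
  `measurePreserving_sumPiEquivProdPi`):
  `∫_{Λ^k} f(x∘σ) 1[hc](x) dx ≤ (∫_{Λ^m} f) · ∫_{Λ^{k-m}} 1[hc](x') dx'`;
* `tsum_factorial_descFactorial_shift` — `#(Fin m ↪ Fin k) z^k/k! = z^m · z^{k-m}/(k-m)!`,
  summed over `k`;
* `tsum_lintegral_indicator_tsum_le` — **the estimate**: the un-normalised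
  `γ_Λ(·|Y)`-expectation of `X ↦ ∑≠_{y ∈ X^m} 1_{Λ^m}(y) f(y)` is at most
  `z^m (∫_{Λ^m} f) · weight z Λ Y univ`, for every boundary condition `Y` — i.e.
  `z^m ρ ≤ (zξ)^m` with `ξ = 1` after normalisation [Richthammer2007, §4.2 (p. 9) with
  Lemma 4 (a) (p. 8)].

The DLR step (3.1), the monotone limit over the boxes `Λ_n ↑ ℝ²` and the assembly of
`Richthammer2007_lemma3_holds` are in `HardDiskTranslationInvarianceStepsProofs.lean`.

## References

* [Richthammer2007] T. Richthammer, *Translation-invariance of two-dimensional Gibbsian point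
  processes*, Comm. Math. Phys. 274 (2007) 81–122, arXiv:0706.3637: §3.3 Lemma 3 and (3.4)
  (p. 7), §3.4 Lemma 4 (a) (p. 8), §4.2 (p. 9).
-/

noncomputable section

open MeasureTheory Set Function
open scoped ENNReal

namespace Literature.Barriers.AtomisticToContinuum.HardDisk

open Literature.Analysis.FunctionSpaces

/-! ### The hard core under removal of thrown points -/

/-- **`e^{-H} ≤ 1`, `e^{-W} ≤ 1` for the hard core.** Removing thrown points preserves the
hard-core constraint in `Λ`: if `{x'_j} ⊆ {x_i}` then `HardCoreIn Λ` passes from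
`superpose Λ x Y` to `superpose Λ x' Y` (Richthammer 2007, Lemma 4 (a): "all energy terms are
nonnegative"). [cite: Richthammer2007, §3.4 Lemma 4 (a) (p. 8)] -/
theorem hardCoreIn_superpose_of_range_subset {Λ : Set (EuclideanSpace ℝ (Fin 2))} {k j : ℕ}
    {x : Fin k → EuclideanSpace ℝ (Fin 2)} {x' : Fin j → EuclideanSpace ℝ (Fin 2)}
    (h : Set.range x' ⊆ Set.range x) (Y : PointConfig (EuclideanSpace ℝ (Fin 2)))
    (hx : HardCoreIn Λ (superpose Λ x Y)) : HardCoreIn Λ (superpose Λ x' Y) := by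
  have hsub : ∀ r, r ∈ superpose Λ x' Y → r ∈ superpose Λ x Y := fun r hr => by
    rcases mem_superpose.1 hr with ⟨hr, hrΛ⟩ | ⟨hr, hrΛ⟩
    · exact mem_superpose.2 (Or.inl ⟨h hr, hrΛ⟩)
    · exact mem_superpose.2 (Or.inr ⟨hr, hrΛ⟩)
  intro p hp q hq hpq hΛ
  exact hx p (hsub p hp) q (hsub q hq) hpq hΛ

/-! ### Tuples of distinct points inside a superposition -/

/-- **The injective `m`-tuples of points of `superpose Λ x Y` lying in `Λ^m` are sub-tuples of
the throw `x`**: the sum of `1_{Λ^m} f` over them is at most `∑_{σ : Fin m ↪ Fin k} f(x ∘ σ)`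
(equality when `x` is injective with values in `Λ`, which holds a.e.; only the inequality is
needed). [cite: Richthammer2007, §4.2 (p. 9), first display] -/
theorem tsum_injective_indicator_le_sum_embedding (Λ : Set (EuclideanSpace ℝ (Fin 2))) {k m : ℕ}
    (x : Fin k → EuclideanSpace ℝ (Fin 2)) (Y : PointConfig (EuclideanSpace ℝ (Fin 2)))
    (f : (Fin m → EuclideanSpace ℝ (Fin 2)) → ℝ≥0∞) :
    ∑' y : {y : Fin m → EuclideanSpace ℝ (Fin 2) // Injective y ∧ ∀ i, y i ∈ superpose Λ x Y},
        (Set.pi univ fun _ => Λ).indicator f y.1 ≤ ∑ σ : Fin m ↪ Fin k, f (x ∘ σ) := by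
  classical
  set T := {y : Fin m → EuclideanSpace ℝ (Fin 2) // Injective y ∧ ∀ i, y i ∈ superpose Λ x Y}
    with hT
  set g : T → ℝ≥0∞ := fun y => (Set.pi univ fun _ => Λ).indicator f y.1 with hg
  have hsupp : support g ⊆ {y : T | ∀ i, y.1 i ∈ Λ} := fun y hy i =>
    mem_of_indicator_ne_zero hy i (mem_univ i)
  rw [← tsum_subtype_eq_of_support_subset hsupp]
  have hmem : ∀ (y : {y : T | ∀ i, y.1 i ∈ Λ}) (i : Fin m), ∃ j, x j = y.1.1 i := fun y i =>
    (mem_superpose_of_mem (y.1.2.2 i)).1 (y.2 i)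
  let ψ : {y : T | ∀ i, y.1 i ∈ Λ} → (Fin m ↪ Fin k) := fun y =>
    ⟨fun i => Classical.choose (hmem y i), fun i i' h => y.1.2.1 (by
      rw [← Classical.choose_spec (hmem y i), ← Classical.choose_spec (hmem y i')]
      exact congrArg x h)⟩
  have hxψ : ∀ y, x ∘ (ψ y) = y.1.1 := fun y => funext fun i => Classical.choose_spec (hmem y i)
  have hinj : Injective ψ := by
    intro y y' h
    apply Subtype.ext
    apply Subtype.ext
    rw [← hxψ y, ← hxψ y', h]
  calc ∑' y : {y : T | ∀ i, y.1 i ∈ Λ}, g y.1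
      = ∑' y : {y : T | ∀ i, y.1 i ∈ Λ}, f (x ∘ ψ y) := by
        refine tsum_congr fun y => ?_
        rw [hxψ y, hg]
        exact indicator_of_mem
          (show y.1.1 ∈ Set.pi univ (fun _ : Fin m => Λ) from fun i _ => y.2 i) f
    _ ≤ ∑' σ : Fin m ↪ Fin k, f (x ∘ σ) :=
        ENNReal.tsum_comp_le_tsum_of_injective hinj (fun σ => f (x ∘ σ))
    _ = ∑ σ : Fin m ↪ Fin k, f (x ∘ σ) := tsum_fintype _

/-! ### Splitting `Λ^k` along an embedding `Fin m ↪ Fin k` -/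

/-- **Splitting `Λ^k = Λ^m × Λ^{k-m}` along `σ`.** For an embedding `σ : Fin m ↪ Fin k`, a
measurable `f ≥ 0` on `(ℝ²)^m` and a boundary condition `Y`,
`∫_{Λ^k} f(x ∘ σ) 1[hard core](x) dx ≤ (∫_{Λ^m} f) · ∫_{Λ^{k-m}} 1[hard core](x') dx'`: the hard
core of the full throw implies that of the sub-throw indexed by the complement of `range σ`
(`hardCoreIn_superpose_of_range_subset`), and `Λ^k ≅ Λ^m × Λ^{k-m}` along
`Fin m ⊕ Fin (k - m) ≃ range σ ⊕ (range σ)ᶜ ≃ Fin k` is measure preserving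
(`measurePreserving_piCongrLeft`, `measurePreserving_sumPiEquivProdPi`).
[cite: Richthammer2007, §4.2 (p. 9)] -/
theorem lintegral_comp_embedding_mul_indicator_le {Λ : Set (EuclideanSpace ℝ (Fin 2))}
    (hΛ : MeasurableSet Λ) {k m : ℕ} (σ : Fin m ↪ Fin k)
    (Y : PointConfig (EuclideanSpace ℝ (Fin 2))) {f : (Fin m → EuclideanSpace ℝ (Fin 2)) → ℝ≥0∞}
    (hf : Measurable f) :
    ∫⁻ x, f (x ∘ σ) * {x | HardCoreIn Λ (superpose Λ x Y)}.indicator 1 x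
        ∂(Measure.pi fun _ : Fin k => volume.restrict Λ) ≤
      (∫⁻ y, f y ∂(Measure.pi fun _ : Fin m => volume.restrict Λ)) *
        ∫⁻ w, {w | HardCoreIn Λ (superpose Λ w Y)}.indicator 1 w
          ∂(Measure.pi fun _ : Fin (k - m) => volume.restrict Λ) := by
  classical
  set ν : Measure (EuclideanSpace ℝ (Fin 2)) := volume.restrict Λ with hν
  -- index bookkeeping: `Fin m ≃ range σ`, `Fin (k - m) ≃ (range σ)ᶜ`, glued to `Fin k`
  set e₁ : Fin m ≃ {i : Fin k // i ∈ Set.range σ} := Equiv.ofInjective σ σ.injective with he₁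
  have hcard : Fintype.card {i : Fin k // i ∉ Set.range σ} = k - m := by
    have h1 : Fintype.card {i : Fin k // i ∈ Set.range σ} = m := by
      convert Set.card_range_of_injective σ.injective using 2
      exact (Fintype.card_fin m).symm
    rw [Fintype.card_subtype_compl, Fintype.card_fin, h1]
  set e₂ : Fin (k - m) ≃ {i : Fin k // i ∉ Set.range σ} := (Fintype.equivFinOfCardEq hcard).symm
    with he₂
  set eσ : Fin m ⊕ Fin (k - m) ≃ Fin k :=
    (Equiv.sumCongr e₁ e₂).trans (Equiv.sumCompl fun i : Fin k => i ∈ Set.range σ) with heσ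
  -- the measurable split `x ↦ (x ∘ σ, x ∘ e₂)`
  set Ψ : (Fin k → EuclideanSpace ℝ (Fin 2)) ≃ᵐ
      (Fin m → EuclideanSpace ℝ (Fin 2)) × (Fin (k - m) → EuclideanSpace ℝ (Fin 2)) :=
    (MeasurableEquiv.piCongrLeft (fun _ : Fin k => EuclideanSpace ℝ (Fin 2)) eσ).symm.trans
      (MeasurableEquiv.sumPiEquivProdPi fun _ : Fin m ⊕ Fin (k - m) => EuclideanSpace ℝ (Fin 2))
    with hΨ
  have hΨ₁ : ∀ x : Fin k → EuclideanSpace ℝ (Fin 2), (Ψ x).1 = x ∘ σ := fun x => by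
    funext i
    simp [hΨ, heσ, he₁, MeasurableEquiv.coe_sumPiEquivProdPi, Equiv.sumPiEquivProdPi,
      MeasurableEquiv.piCongrLeft, Equiv.piCongrLeft_symm_apply]
  have hΨ₂ : ∀ x : Fin k → EuclideanSpace ℝ (Fin 2), (Ψ x).2 = fun j => x (e₂ j) := fun x => by
    funext j
    simp [hΨ, heσ, MeasurableEquiv.coe_sumPiEquivProdPi, Equiv.sumPiEquivProdPi,
      MeasurableEquiv.piCongrLeft, Equiv.piCongrLeft_symm_apply]
  have hmp : MeasurePreserving Ψ (Measure.pi fun _ : Fin k => ν)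
      ((Measure.pi fun _ : Fin m => ν).prod (Measure.pi fun _ : Fin (k - m) => ν)) :=
    ((measurePreserving_piCongrLeft (fun _ : Fin k => ν) eσ).symm _).trans
      (measurePreserving_sumPiEquivProdPi fun _ : Fin m ⊕ Fin (k - m) => ν)
  -- Step 1: the hard core of the throw implies that of the sub-throw outside `range σ`
  have hpt : ∀ x : Fin k → EuclideanSpace ℝ (Fin 2),
      f (x ∘ σ) * {x | HardCoreIn Λ (superpose Λ x Y)}.indicator 1 x ≤
        f (Ψ x).1 * {w | HardCoreIn Λ (superpose Λ w Y)}.indicator 1 (Ψ x).2 := by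
    intro x
    rw [hΨ₁ x, hΨ₂ x]
    gcongr
    by_cases hx : x ∈ {x : Fin k → EuclideanSpace ℝ (Fin 2) | HardCoreIn Λ (superpose Λ x Y)}
    · have hx' : (fun j => x (e₂ j)) ∈
          {w : Fin (k - m) → EuclideanSpace ℝ (Fin 2) | HardCoreIn Λ (superpose Λ w Y)} :=
        hardCoreIn_superpose_of_range_subset (x' := fun j => x (e₂ j))
          (by rintro _ ⟨j, rfl⟩; exact ⟨_, rfl⟩) Y hx
      rw [indicator_of_mem hx, indicator_of_mem hx']
      exact le_rfl
    · rw [indicator_of_notMem hx]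
      exact zero_le
  -- Step 2: change variables along `Ψ` and use Tonelli on the product
  have hmeas₂ : Measurable fun w : Fin (k - m) → EuclideanSpace ℝ (Fin 2) =>
      {w | HardCoreIn Λ (superpose Λ w Y)}.indicator
        (1 : (Fin (k - m) → EuclideanSpace ℝ (Fin 2)) → ℝ≥0∞) w :=
    measurable_one.indicator (measurableSet_hardCoreIn_superpose_left hΛ (k - m) Y)
  calc ∫⁻ x, f (x ∘ σ) * {x | HardCoreIn Λ (superpose Λ x Y)}.indicator 1 x
          ∂(Measure.pi fun _ : Fin k => ν)
      ≤ ∫⁻ x, f (Ψ x).1 * {w | HardCoreIn Λ (superpose Λ w Y)}.indicator 1 (Ψ x).2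
            ∂(Measure.pi fun _ : Fin k => ν) := lintegral_mono hpt
    _ = ∫⁻ q, f q.1 * {w | HardCoreIn Λ (superpose Λ w Y)}.indicator 1 q.2
            ∂((Measure.pi fun _ : Fin m => ν).prod (Measure.pi fun _ : Fin (k - m) => ν)) :=
        hmp.lintegral_comp_emb Ψ.measurableEmbedding
          (fun q => f q.1 * {w | HardCoreIn Λ (superpose Λ w Y)}.indicator 1 q.2)
    _ = (∫⁻ y, f y ∂(Measure.pi fun _ : Fin m => ν)) *
          ∫⁻ w, {w | HardCoreIn Λ (superpose Λ w Y)}.indicator 1 w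
            ∂(Measure.pi fun _ : Fin (k - m) => ν) :=
        lintegral_prod_mul hf.aemeasurable hmeas₂.aemeasurable

/-! ### Counting embeddings and re-summing the series -/

/-- Re-indexing a series supported on `k ≥ m` by `k = j + m`. [folklore] -/
theorem tsum_ite_le_shift (m : ℕ) (b : ℕ → ℝ≥0∞) :
    ∑' k : ℕ, (if m ≤ k then b (k - m) else 0) = ∑' j : ℕ, b j := by
  have hsupp : support (fun k : ℕ => if m ≤ k then b (k - m) else 0) ⊆
      Set.range fun j => j + m := by
    intro k hk
    rw [mem_support] at hk
    have hmk : m ≤ k := by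
      by_contra h
      exact hk (if_neg h)
    exact ⟨k - m, Nat.sub_add_cancel hmk⟩
  rw [← (add_left_injective m).tsum_eq hsupp]
  refine tsum_congr fun j => ?_
  simp only [le_add_iff_nonneg_left, zero_le, if_true, Nat.add_sub_cancel]

/-- **`#(Fin m ↪ Fin k) · z^k/k! = z^m · z^{k-m}/(k-m)!`, summed over `k`.** For `z ≥ 0` and any
`a : ℕ → [0, ∞]`,
`∑_k (z^k/k!) (k)_m a_{k-m} = z^m ∑_j (z^j/j!) a_j` (`(k)_m = k!/(k-m)!`, zero for `k < m`).
[folklore] -/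
theorem tsum_factorial_descFactorial_shift {z : ℝ} (hz : 0 ≤ z) (m : ℕ) (a : ℕ → ℝ≥0∞) :
    ∑' k : ℕ, ENNReal.ofReal (z ^ k / k.factorial) * ((k.descFactorial m : ℝ≥0∞) * a (k - m)) =
      ENNReal.ofReal z ^ m * ∑' j : ℕ, ENNReal.ofReal (z ^ j / j.factorial) * a j := by
  have hterm : ∀ k : ℕ,
      ENNReal.ofReal (z ^ k / k.factorial) * ((k.descFactorial m : ℝ≥0∞) * a (k - m)) =
        if m ≤ k then ENNReal.ofReal z ^ m *
          (ENNReal.ofReal (z ^ (k - m) / (k - m).factorial) * a (k - m)) else 0 := by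
    intro k
    by_cases hkm : m ≤ k
    · rw [if_pos hkm, ← mul_assoc, ← mul_assoc]
      congr 1
      rw [← ENNReal.ofReal_natCast, ← ENNReal.ofReal_pow hz,
        ← ENNReal.ofReal_mul (div_nonneg (pow_nonneg hz _) (Nat.cast_nonneg _)),
        ← ENNReal.ofReal_mul (pow_nonneg hz _)]
      congr 1
      have hfac : ((k - m).factorial : ℝ) * (k.descFactorial m : ℝ) = k.factorial := by
        exact_mod_cast Nat.factorial_mul_descFactorial hkm
      have hpow : z ^ k = z ^ m * z ^ (k - m) := by
        rw [← pow_add, Nat.add_sub_cancel' hkm]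
      have hf0 : ((k - m).factorial : ℝ) ≠ 0 := by positivity
      have hd0 : (k.descFactorial m : ℝ) ≠ 0 := by
        exact_mod_cast fun h => (not_le.2 (Nat.descFactorial_eq_zero_iff_lt.1 h)) hkm
      rw [← hfac, hpow]
      field_simp
    · rw [if_neg hkm, Nat.descFactorial_eq_zero_iff_lt.2 (not_le.1 hkm)]
      simp
  simp_rw [hterm]
  rw [tsum_ite_le_shift m (fun j => ENNReal.ofReal z ^ m *
      (ENNReal.ofReal (z ^ j / j.factorial) * a j)), ENNReal.tsum_mul_left]

/-! ### The estimate -/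

/-- **The per-volume bound.** For each number `k` of thrown points,
`∫_{Λ^k} 1[hc](x) ∑≠_{y ∈ (X_Λ Y_{Λᶜ})^m} 1_{Λ^m}(y) f(y) dx ≤ (k)_m (∫_{Λ^m} f) ∫_{Λ^{k-m}} 1[hc]`,
`X = {x_i}`. [cite: Richthammer2007, §4.2 (p. 9)] -/
theorem lintegral_indicator_tsum_injective_le {Λ : Set (EuclideanSpace ℝ (Fin 2))}
    (hΛ : MeasurableSet Λ) (k : ℕ) {m : ℕ} (Y : PointConfig (EuclideanSpace ℝ (Fin 2)))
    {f : (Fin m → EuclideanSpace ℝ (Fin 2)) → ℝ≥0∞} (hf : Measurable f) :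
    ∫⁻ x, {x | HardCoreIn Λ (superpose Λ x Y)}.indicator
        (fun x => ∑' y : {y : Fin m → EuclideanSpace ℝ (Fin 2) //
            Injective y ∧ ∀ i, y i ∈ superpose Λ x Y}, (Set.pi univ fun _ => Λ).indicator f y.1) x
        ∂(Measure.pi fun _ : Fin k => volume.restrict Λ) ≤
      (k.descFactorial m : ℝ≥0∞) *
        ((∫⁻ y, f y ∂(Measure.pi fun _ : Fin m => volume.restrict Λ)) *
          ∫⁻ w, {w | HardCoreIn Λ (superpose Λ w Y)}.indicator 1 w
            ∂(Measure.pi fun _ : Fin (k - m) => volume.restrict Λ)) := by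
  have hpt : ∀ x : Fin k → EuclideanSpace ℝ (Fin 2),
      {x | HardCoreIn Λ (superpose Λ x Y)}.indicator
        (fun x => ∑' y : {y : Fin m → EuclideanSpace ℝ (Fin 2) //
            Injective y ∧ ∀ i, y i ∈ superpose Λ x Y}, (Set.pi univ fun _ => Λ).indicator f y.1) x ≤
        ∑ σ : Fin m ↪ Fin k, f (x ∘ σ) * {x | HardCoreIn Λ (superpose Λ x Y)}.indicator 1 x := by
    intro x
    by_cases hx : x ∈ {x : Fin k → EuclideanSpace ℝ (Fin 2) | HardCoreIn Λ (superpose Λ x Y)}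
    · simp_rw [indicator_of_mem hx, Pi.one_apply, mul_one]
      exact tsum_injective_indicator_le_sum_embedding Λ x Y f
    · rw [indicator_of_notMem hx]
      exact zero_le
  have hmeas : ∀ σ : Fin m ↪ Fin k, Measurable fun x : Fin k → EuclideanSpace ℝ (Fin 2) =>
      f (x ∘ σ) * {x | HardCoreIn Λ (superpose Λ x Y)}.indicator 1 x := fun σ =>
    (hf.comp (measurable_pi_lambda (fun x : Fin k → EuclideanSpace ℝ (Fin 2) => x ∘ σ)
      fun i => measurable_pi_apply (σ i))).mul
      (measurable_one.indicator (measurableSet_hardCoreIn_superpose_left hΛ k Y))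
  calc ∫⁻ x, {x | HardCoreIn Λ (superpose Λ x Y)}.indicator
          (fun x => ∑' y : {y : Fin m → EuclideanSpace ℝ (Fin 2) //
            Injective y ∧ ∀ i, y i ∈ superpose Λ x Y}, (Set.pi univ fun _ => Λ).indicator f y.1) x
          ∂(Measure.pi fun _ : Fin k => volume.restrict Λ)
      ≤ ∫⁻ x, ∑ σ : Fin m ↪ Fin k, f (x ∘ σ) * {x | HardCoreIn Λ (superpose Λ x Y)}.indicator 1 x
          ∂(Measure.pi fun _ : Fin k => volume.restrict Λ) := lintegral_mono hpt
    _ = ∑ σ : Fin m ↪ Fin k, ∫⁻ x, f (x ∘ σ) * {x | HardCoreIn Λ (superpose Λ x Y)}.indicator 1 x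
          ∂(Measure.pi fun _ : Fin k => volume.restrict Λ) :=
        lintegral_finsetSum _ fun σ _ => hmeas σ
    _ ≤ ∑ _σ : Fin m ↪ Fin k, (∫⁻ y, f y ∂(Measure.pi fun _ : Fin m => volume.restrict Λ)) *
          ∫⁻ w, {w | HardCoreIn Λ (superpose Λ w Y)}.indicator 1 w
            ∂(Measure.pi fun _ : Fin (k - m) => volume.restrict Λ) :=
        Finset.sum_le_sum fun σ _ => lintegral_comp_embedding_mul_indicator_le hΛ σ Y hf
    _ = _ := by
        rw [Finset.sum_const, Finset.card_univ, Fintype.card_embedding_eq, Fintype.card_fin,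
          Fintype.card_fin, nsmul_eq_mul]

/-- The partition function as the series of the hard-core volumes:
`weight z Λ Y univ = ∑_k (z^k/k!) ∫_{Λ^k} 1[hard core] dx`. [cite: Richthammer2007, §3.3 (p. 7)] -/
theorem weight_univ_eq_tsum (z : ℝ) (Λ : Set (EuclideanSpace ℝ (Fin 2)))
    (Y : PointConfig (EuclideanSpace ℝ (Fin 2))) :
    weight z Λ Y univ = ∑' k : ℕ, ENNReal.ofReal (z ^ k / k.factorial) *
      ∫⁻ w, {w | HardCoreIn Λ (superpose Λ w Y)}.indicator 1 w
        ∂(Measure.pi fun _ : Fin k => volume.restrict Λ) := by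
  unfold weight
  refine tsum_congr fun k => ?_
  congr 1
  refine lintegral_congr fun w => ?_
  rw [univ_inter]
  rfl

/-- **The Ruelle estimate for the hard-disc specification** (Richthammer 2007, §4.2 with the
Ruelle bound `ξ = 1` of Lemma 4 (a)). For `z ≥ 0`, a measurable `Λ`, a boundary condition `Y`
and a measurable `f ≥ 0` on `(ℝ²)^m`, the un-normalised finite-volume Gibbs expectation
`∑_k (z^k/k!) ∫_{Λ^k} 1[hc](x) F(X_Λ Y_{Λᶜ}) dx` of `F : X ↦ ∑≠_{y₁,…,y_m ∈ X} 1_{Λ^m}(y) f(y)` is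
at most `z^m (∫_{Λ^m} f dx) · weight z Λ Y univ`; after dividing by the partition function this
is `∫ γ_Λ(dX|Y) ∑≠ 1_{Λ^m} f ≤ z^m ∫_{Λ^m} f`, i.e. `z^m ρ ≤ (zξ)^m` with `ξ = 1`.
[cite: Richthammer2007, §4.2 (p. 9) and §3.4 Lemma 4 (a) (p. 8)] -/
theorem tsum_lintegral_indicator_tsum_le {z : ℝ} (hz : 0 ≤ z) {Λ : Set (EuclideanSpace ℝ (Fin 2))}
    (hΛ : MeasurableSet Λ) (Y : PointConfig (EuclideanSpace ℝ (Fin 2))) {m : ℕ}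
    {f : (Fin m → EuclideanSpace ℝ (Fin 2)) → ℝ≥0∞} (hf : Measurable f) :
    ∑' k : ℕ, ENNReal.ofReal (z ^ k / k.factorial) *
        ∫⁻ x, {x | HardCoreIn Λ (superpose Λ x Y)}.indicator
          (fun x => ∑' y : {y : Fin m → EuclideanSpace ℝ (Fin 2) //
            Injective y ∧ ∀ i, y i ∈ superpose Λ x Y}, (Set.pi univ fun _ => Λ).indicator f y.1) x
          ∂(Measure.pi fun _ : Fin k => volume.restrict Λ) ≤
      ENNReal.ofReal z ^ m * (∫⁻ y, f y ∂(Measure.pi fun _ : Fin m => volume.restrict Λ)) *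
        weight z Λ Y univ := by
  set I := ∫⁻ y, f y ∂(Measure.pi fun _ : Fin m => volume.restrict Λ) with hI
  set H : ℕ → ℝ≥0∞ := fun j => ∫⁻ w, {w | HardCoreIn Λ (superpose Λ w Y)}.indicator 1 w
    ∂(Measure.pi fun _ : Fin j => volume.restrict Λ) with hH
  calc ∑' k : ℕ, ENNReal.ofReal (z ^ k / k.factorial) *
        ∫⁻ x, {x | HardCoreIn Λ (superpose Λ x Y)}.indicator
          (fun x => ∑' y : {y : Fin m → EuclideanSpace ℝ (Fin 2) //
            Injective y ∧ ∀ i, y i ∈ superpose Λ x Y}, (Set.pi univ fun _ => Λ).indicator f y.1) x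
          ∂(Measure.pi fun _ : Fin k => volume.restrict Λ)
      ≤ ∑' k : ℕ, ENNReal.ofReal (z ^ k / k.factorial) *
          ((k.descFactorial m : ℝ≥0∞) * (I * H (k - m))) :=
        ENNReal.tsum_le_tsum fun k => by
          gcongr
          exact lintegral_indicator_tsum_injective_le hΛ k Y hf
    _ = ENNReal.ofReal z ^ m * ∑' j : ℕ, ENNReal.ofReal (z ^ j / j.factorial) * (I * H j) :=
        tsum_factorial_descFactorial_shift hz m (fun j => I * H j)
    _ = ENNReal.ofReal z ^ m * (I * ∑' j : ℕ, ENNReal.ofReal (z ^ j / j.factorial) * H j) := by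
        congr 1
        rw [← ENNReal.tsum_mul_left]
        exact tsum_congr fun j => mul_left_comm _ _ _
    _ = ENNReal.ofReal z ^ m * I * weight z Λ Y univ := by
        rw [weight_univ_eq_tsum, mul_assoc]

end Literature.Barriers.AtomisticToContinuum.HardDisk

end
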